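import Summits.CriticalPhenomena.PercolationContinuityZ3.Theorems.PercNearOneGluingNoHeavyQuantTwoMidCellPolyA
import Summits.CriticalPhenomena.PercolationContinuityZ3.Theorems.PercNearOneGluingNoHeavyQuantTwoMidCellPolyB
import Summits.CriticalPhenomena.PercolationContinuityZ3.Theorems.PercNearOneGluingNoHeavyQuantTwoMidCellPolyC
import Summits.CriticalPhenomena.PercolationContinuityZ3.Theorems.PercNearOneGluingNoHeavyQuantCrossGiantCellReal
import HarnessLib

/-!
# QUANT lane R8, T-DEC: the TWO-MID CELL of `LightSliceLowCrossBelow` — RATE LEMMAS: the breakpoint inequalities of the two brackets in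
# closed form (light usage `U_ℓ`, heavy usage `ρ/(1−ρ)`), from the polynomial certificates of parts A–D (census-2 g60)

builds on p205010 (kernel theorem, internal audit signed; external expert review pending)

Support file (`--supports stmt-CriticalPhenomena-4575`), QUANT lane seat prim-quant-census-2 (gen 60), rung R8 of
`run/shared/lean/prim/quant/LADDER.md`.  Memo `run/shared/lean/prim/quant/prim-quant-census-2-g60/TWO-MID-G60.md`.  Theorems only (real
analysis), standard axioms, no sorries, no definitions.

SETTING (memo §2; `…QuantTwoMidCellReal` for the assembly).  Floor `0 < x < 1`; side 1's light credit pair of rate `0 ≤ r < x`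
(`γ = x² + (1−x)r`); side 2's atom: cheap rate `c = ρ_c < x`, expensive rate `ρe ∈ (x,1)`, span ratio `0 < a < 1` with the LOW CROSS
`(2−r)a < c`, `ε = (h−l)/(h′−l′)` with `2 − c ≤ ε(2 − ρe)` (Type II: `h′ < h`; equality = Type I).  Rates of the cross pairs into the head mid
`p + h′`: `ρ_P = c + ra` (`P2`), `ρ_M = (c + ra − 2a)/(1−a)` (`M2`, always light); into the second mid `p + h`: `ρ_S = ρe + ra/ε` (`P1`),
`ρ_N = ρe − a(2−ρe−r)/(ε−a)` (`M1`).  `U_ℓ(ρ) = (x² + (1−x)ρ)/((1−x)(1+x−ρ))` (notation `UL[x, ρ]`).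
* bracket 2 (`P2`, `M2` against the head mid, capacity `c₂ = U_ℓ(c)` per unit cheap low mass): `R_Al`/`R_Ah` (`v₁ ≥ 0`, light/heavy `P2`),
  `R_Bl`/`R_Bh` (`v₁ ≥ ℓ := 2ra(1−2γ)` when `γ ≤ 1/2`), `R_C` (`v₂ ≥ ℓ`), `R_D` (`ℓ ≤ γ`).
* bracket 1 (`P1`, `M1` against the second mid `p + h`) is in `…TwoMidCellCoupling` (`R_E`, `R_E2`, `R_L`, `R_F`).
Helpers: `UL_sub`, `UL_mono`, `UL_pos`, `UH_mono`, `UL_frac`.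

[this work].  The gluing rows served [cite: KozmaNitzan2024, Conjecture 3 (p. 15)]; product measure [cite: Grimmett1999, §1.3 p. 10].
-/

noncomputable section

namespace Summit.CriticalPhenomena.PercolationContinuityZ3.Theorems

namespace Quant

namespace LawDec

namespace TwoMidCell

/-- light usage `U_ℓ(ρ) = (x² + (1−x)ρ)/((1−x)(1+x−ρ))` -/
local notation3 "UL[" x ", " ρ "]" => ((x : ℝ) ^ 2 + (1 - x) * ρ) / ((1 - x) * (1 + x - ρ))

/-! ### elementary facts on the light usage -/

/-- difference of light usages. -/
theorem UL_sub (x ρ₁ ρ₂ : ℝ) (hx1 : x < 1) (h₁ : ρ₁ < 1 + x) (h₂ : ρ₂ < 1 + x) :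
    UL[x, ρ₁] - UL[x, ρ₂] = (ρ₁ - ρ₂) / ((1 - x) * (1 + x - ρ₁) * (1 + x - ρ₂)) := by
  have h1x : (1 : ℝ) - x ≠ 0 := by linarith
  have d1 : (1 : ℝ) + x - ρ₁ ≠ 0 := by linarith
  have d2 : (1 : ℝ) + x - ρ₂ ≠ 0 := by linarith
  field_simp
  ring


/-- `U_ℓ` is monotone. -/
theorem UL_mono (x ρ₁ ρ₂ : ℝ) (hx1 : x < 1) (h₁ : ρ₁ < 1 + x) (h₂ : ρ₂ < 1 + x) (h : ρ₂ ≤ ρ₁) : UL[x, ρ₂] ≤ UL[x, ρ₁] := by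
  have := UL_sub x ρ₁ ρ₂ hx1 h₁ h₂
  have hpos : 0 ≤ (ρ₁ - ρ₂) / ((1 - x) * (1 + x - ρ₁) * (1 + x - ρ₂)) :=
    div_nonneg (by linarith) (mul_nonneg (mul_nonneg (by linarith) (by linarith)) (by linarith))
  linarith


/-- `U_ℓ > 0`. -/
theorem UL_pos (x ρ : ℝ) (hx0 : 0 < x) (hx1 : x < 1) (hρ0 : 0 ≤ ρ) (hρ : ρ < 1 + x) : 0 < UL[x, ρ] :=
  div_pos (by nlinarith) (mul_pos (by linarith) (by linarith))


/-- the heavy usage `ρ/(1−ρ)` is monotone. -/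
theorem UH_mono (ρ₁ ρ₂ : ℝ) (h₁ : ρ₁ < 1) (h : ρ₂ ≤ ρ₁) : ρ₂ / (1 - ρ₂) ≤ ρ₁ / (1 - ρ₁) := by
  rw [div_le_div_iff₀ (by linarith) (by linarith)]; nlinarith



/-- `U_ℓ` at a quotient rate: `U_ℓ(q/d) = (x² d + (1−x) q)/((1−x)((1+x) d − q))`. -/
theorem UL_frac (x q d : ℝ) (hx1 : x < 1) (hd : d ≠ 0) (hden : (1 + x) * d - q ≠ 0) :
    UL[x, q / d] = (x ^ 2 * d + (1 - x) * q) / ((1 - x) * ((1 + x) * d - q)) := by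
  have h1x : (1 : ℝ) - x ≠ 0 := by linarith
  rw [div_eq_div_iff (mul_ne_zero h1x (by
      intro h
      apply hden
      have : (1 + x - q / d) * d = 0 := by rw [h, zero_mul]
      have e : (1 + x - q / d) * d = (1 + x) * d - q := by field_simp
      linarith [e.symm.trans this])) (mul_ne_zero h1x hden)]
  field_simp


/-! ### bracket 2 -/

set_option maxHeartbeats 4000000 in
/-- **(A, light `P2`) `v₁ ≥ 0`.** [this work] -/
theorem R_Al (x r c a γ ρP ρM : ℝ) (hγ : γ = x ^ 2 + (1 - x) * r) (hρP : ρP = c + r * a) (hρM : ρM = (c + r * a - 2 * a) / (1 - a))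
    (hx0 : 0 < x) (hx1 : x < 1) (hr0 : 0 ≤ r) (hrx : r < x) (hcx : c < x) (ha0 : 0 < a) (ha1 : a < 1)
    (hlc : (2 - r) * a < c) (hP : ρP ≤ x) :
    0 ≤ (1 - γ) * (UL[x, c] - UL[x, ρP]) + γ * (UL[x, ρP] - UL[x, ρM]) := by
  subst hγ hρP hρM
  have h1x : 0 < 1 - x := by linarith
  have hc0 : 0 < c := by nlinarith
  have hW : 0 < (1 + x) * (1 - a) - (c + r * a - 2 * a) := by nlinarith
  have hd2 : 0 < 1 + x - c := by linarith
  have hd3 : 0 < 1 + x - (c + r * a) := by linarith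
  rw [UL_frac x (c + r * a - 2 * a) (1 - a) hx1 (by linarith) hW.ne']
  have hD : 0 < (1 - x) * (1 + x - c) * (1 + x - (c + r * a)) * ((1 + x) * (1 - a) - (c + r * a - 2 * a)) :=
    mul_pos (mul_pos (mul_pos h1x hd2) hd3) hW
  have e1 := UL_sub x c (c + r * a) hx1 (by linarith) (by linarith)
  have e2 : UL[x, c + r * a] - (x ^ 2 * (1 - a) + (1 - x) * (c + r * a - 2 * a)) / ((1 - x) * ((1 + x) * (1 - a) - (c + r * a - 2 * a)))
      = a * (2 - (c + r * a)) / ((1 - x) * (1 + x - (c + r * a)) * ((1 + x) * (1 - a) - (c + r * a - 2 * a))) := by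
    rw [div_sub_div _ _ (mul_ne_zero h1x.ne' hd3.ne') (mul_ne_zero h1x.ne' hW.ne'), div_eq_div_iff (by positivity) (by positivity)]
    ring
  have k1 : (c - (c + r * a)) / ((1 - x) * (1 + x - c) * (1 + x - (c + r * a)))
      * ((1 - x) * (1 + x - c) * (1 + x - (c + r * a)) * ((1 + x) * (1 - a) - (c + r * a - 2 * a)))
      = (c - (c + r * a)) * ((1 + x) * (1 - a) - (c + r * a - 2 * a)) := by
    rw [div_mul_eq_mul_div, div_eq_iff (mul_ne_zero (mul_ne_zero h1x.ne' hd2.ne') hd3.ne')]; ring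
  have k2 : a * (2 - (c + r * a)) / ((1 - x) * (1 + x - (c + r * a)) * ((1 + x) * (1 - a) - (c + r * a - 2 * a)))
      * ((1 - x) * (1 + x - c) * (1 + x - (c + r * a)) * ((1 + x) * (1 - a) - (c + r * a - 2 * a)))
      = a * (2 - (c + r * a)) * (1 + x - c) := by
    rw [div_mul_eq_mul_div, div_eq_iff (mul_ne_zero (mul_ne_zero h1x.ne' hd3.ne') hW.ne')]; ring
  have hT := poly_Al x r c a hx0.le (by linarith) hr0 (by linarith) hc0.le (by linarith) ha0.le (by linarith) (by linarith)
  refine (mul_nonneg_iff_of_pos_right hD).1 ?_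
  rw [e1, e2]
  have eq : ((1 - (x ^ 2 + (1 - x) * r)) * ((c - (c + r * a)) / ((1 - x) * (1 + x - c) * (1 + x - (c + r * a))))
      + (x ^ 2 + (1 - x) * r) * (a * (2 - (c + r * a)) / ((1 - x) * (1 + x - (c + r * a)) * ((1 + x) * (1 - a) - (c + r * a - 2 * a)))))
      * ((1 - x) * (1 + x - c) * (1 + x - (c + r * a)) * ((1 + x) * (1 - a) - (c + r * a - 2 * a)))
      = (1 - (x ^ 2 + (1 - x) * r)) * ((c - (c + r * a)) / ((1 - x) * (1 + x - c) * (1 + x - (c + r * a)))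
          * ((1 - x) * (1 + x - c) * (1 + x - (c + r * a)) * ((1 + x) * (1 - a) - (c + r * a - 2 * a))))
        + (x ^ 2 + (1 - x) * r) * (a * (2 - (c + r * a)) / ((1 - x) * (1 + x - (c + r * a)) * ((1 + x) * (1 - a) - (c + r * a - 2 * a)))
          * ((1 - x) * (1 + x - c) * (1 + x - (c + r * a)) * ((1 + x) * (1 - a) - (c + r * a - 2 * a)))) := by ring
  rw [eq, k1, k2]
  have := mul_nonneg ha0.le hT
  linarith


set_option maxHeartbeats 4000000 in
/-- **(B, light `P2`) `ℓ·U_P ≤ v₁·U_P`** (`γ ≤ 1/2`). [this work] -/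
theorem R_Bl (x r c a γ ρP ρM : ℝ) (hγ : γ = x ^ 2 + (1 - x) * r) (hρP : ρP = c + r * a) (hρM : ρM = (c + r * a - 2 * a) / (1 - a))
    (hx0 : 0 < x) (hx1 : x < 1) (hr0 : 0 ≤ r) (hrx : r < x) (hcx : c < x) (ha0 : 0 < a) (ha1 : a < 1)
    (hlc : (2 - r) * a < c) (hP : ρP ≤ x) (hg : γ ≤ 1 / 2) :
    2 * r * a * (1 - 2 * γ) * UL[x, ρP] ≤ (1 - γ) * (UL[x, c] - UL[x, ρP]) + γ * (UL[x, ρP] - UL[x, ρM]) := by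
  subst hγ hρP hρM
  have h1x : 0 < 1 - x := by linarith
  have hc0 : 0 < c := by nlinarith
  have hW : 0 < (1 + x) * (1 - a) - (c + r * a - 2 * a) := by nlinarith
  have hd2 : 0 < 1 + x - c := by linarith
  have hd3 : 0 < 1 + x - (c + r * a) := by linarith
  rw [UL_frac x (c + r * a - 2 * a) (1 - a) hx1 (by linarith) hW.ne']
  have hD : 0 < (1 - x) * (1 + x - c) * (1 + x - (c + r * a)) * ((1 + x) * (1 - a) - (c + r * a - 2 * a)) :=
    mul_pos (mul_pos (mul_pos h1x hd2) hd3) hW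
  have e1 := UL_sub x c (c + r * a) hx1 (by linarith) (by linarith)
  have e2 : UL[x, c + r * a] - (x ^ 2 * (1 - a) + (1 - x) * (c + r * a - 2 * a)) / ((1 - x) * ((1 + x) * (1 - a) - (c + r * a - 2 * a)))
      = a * (2 - (c + r * a)) / ((1 - x) * (1 + x - (c + r * a)) * ((1 + x) * (1 - a) - (c + r * a - 2 * a))) := by
    rw [div_sub_div _ _ (mul_ne_zero h1x.ne' hd3.ne') (mul_ne_zero h1x.ne' hW.ne'), div_eq_div_iff (by positivity) (by positivity)]
    ring
  have k1 : (c - (c + r * a)) / ((1 - x) * (1 + x - c) * (1 + x - (c + r * a)))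
      * ((1 - x) * (1 + x - c) * (1 + x - (c + r * a)) * ((1 + x) * (1 - a) - (c + r * a - 2 * a)))
      = (c - (c + r * a)) * ((1 + x) * (1 - a) - (c + r * a - 2 * a)) := by
    rw [div_mul_eq_mul_div, div_eq_iff (mul_ne_zero (mul_ne_zero h1x.ne' hd2.ne') hd3.ne')]; ring
  have k2 : a * (2 - (c + r * a)) / ((1 - x) * (1 + x - (c + r * a)) * ((1 + x) * (1 - a) - (c + r * a - 2 * a)))
      * ((1 - x) * (1 + x - c) * (1 + x - (c + r * a)) * ((1 + x) * (1 - a) - (c + r * a - 2 * a)))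
      = a * (2 - (c + r * a)) * (1 + x - c) := by
    rw [div_mul_eq_mul_div, div_eq_iff (mul_ne_zero (mul_ne_zero h1x.ne' hd3.ne') hW.ne')]; ring
  have hT := poly_Bl x r c a hx0.le (by linarith) hr0 (by linarith) hc0.le (by linarith) ha0.le (by linarith) (by linarith) (by linarith) (by linarith) (by nlinarith [mul_nonneg hx0.le (sub_nonneg.2 hrx.le)]) (by nlinarith [mul_nonneg (sub_nonneg.2 hx1.le) (sub_nonneg.2 hrx.le)]) (by nlinarith) (by nlinarith) (by linarith) (by nlinarith [mul_nonneg (sub_nonneg.2 hx1.le) (sub_nonneg.2 hlc.le)]) (by nlinarith [mul_nonneg ha0.le (sub_nonneg.2 hrx.le)]) (by linarith) (by nlinarith [mul_nonneg (sub_nonneg.2 hx1.le) (mul_nonneg hr0 ha0.le)])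
  have k3 : UL[x, c + r * a] * ((1 - x) * (1 + x - c) * (1 + x - (c + r * a)) * ((1 + x) * (1 - a) - (c + r * a - 2 * a)))
      = (x ^ 2 + (1 - x) * (c + r * a)) * (1 + x - c) * ((1 + x) * (1 - a) - (c + r * a - 2 * a)) := by
    rw [div_mul_eq_mul_div, div_eq_iff (mul_ne_zero h1x.ne' hd3.ne')]; ring
  rw [← sub_nonneg]
  refine (mul_nonneg_iff_of_pos_right hD).1 ?_
  rw [e1, e2]
  have eq : ((1 - (x ^ 2 + (1 - x) * r)) * ((c - (c + r * a)) / ((1 - x) * (1 + x - c) * (1 + x - (c + r * a))))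
      + (x ^ 2 + (1 - x) * r) * (a * (2 - (c + r * a)) / ((1 - x) * (1 + x - (c + r * a)) * ((1 + x) * (1 - a) - (c + r * a - 2 * a))))
      - 2 * r * a * (1 - 2 * (x ^ 2 + (1 - x) * r)) * UL[x, c + r * a])
      * ((1 - x) * (1 + x - c) * (1 + x - (c + r * a)) * ((1 + x) * (1 - a) - (c + r * a - 2 * a)))
      = (1 - (x ^ 2 + (1 - x) * r)) * ((c - (c + r * a)) / ((1 - x) * (1 + x - c) * (1 + x - (c + r * a)))
          * ((1 - x) * (1 + x - c) * (1 + x - (c + r * a)) * ((1 + x) * (1 - a) - (c + r * a - 2 * a))))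
        + (x ^ 2 + (1 - x) * r) * (a * (2 - (c + r * a)) / ((1 - x) * (1 + x - (c + r * a)) * ((1 + x) * (1 - a) - (c + r * a - 2 * a)))
          * ((1 - x) * (1 + x - c) * (1 + x - (c + r * a)) * ((1 + x) * (1 - a) - (c + r * a - 2 * a))))
        - 2 * r * a * (1 - 2 * (x ^ 2 + (1 - x) * r)) * (UL[x, c + r * a]
          * ((1 - x) * (1 + x - c) * (1 + x - (c + r * a)) * ((1 + x) * (1 - a) - (c + r * a - 2 * a)))) := by ring
  rw [eq, k1, k2, k3]
  have := mul_nonneg ha0.le hT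
  linarith


set_option maxHeartbeats 4000000 in
/-- **(A, heavy `P2`) `v₁ ≥ 0`.** [this work] -/
theorem R_Ah (x r c a γ ρP ρM : ℝ) (hγ : γ = x ^ 2 + (1 - x) * r) (hρP : ρP = c + r * a) (hρM : ρM = (c + r * a - 2 * a) / (1 - a))
    (hx0 : 0 < x) (hx1 : x < 1) (hr0 : 0 ≤ r) (hrx : r < x) (hcx : c < x) (ha0 : 0 < a) (ha1 : a < 1)
    (hlc : (2 - r) * a < c) (hP : x ≤ ρP) (hP1 : ρP < 1) :
    0 ≤ (1 - γ) * (UL[x, c] - ρP / (1 - ρP)) + γ * (ρP / (1 - ρP) - UL[x, ρM]) := by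
  subst hγ hρP hρM
  have h1x : 0 < 1 - x := by linarith
  have hc0 : 0 < c := by nlinarith
  have hW : 0 < (1 + x) * (1 - a) - (c + r * a - 2 * a) := by nlinarith
  have hd2 : 0 < 1 + x - c := by linarith
  have hdP : 0 < 1 - (c + r * a) := by linarith
  rw [UL_frac x (c + r * a - 2 * a) (1 - a) hx1 (by linarith) hW.ne']
  have hD : 0 < (1 - x) * (1 + x - c) * (1 - (c + r * a)) * ((1 + x) * (1 - a) - (c + r * a - 2 * a)) :=
    mul_pos (mul_pos (mul_pos h1x hd2) hdP) hW
  have k1 : UL[x, c] * ((1 - x) * (1 + x - c) * (1 - (c + r * a)) * ((1 + x) * (1 - a) - (c + r * a - 2 * a)))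
      = (x ^ 2 + (1 - x) * c) * (1 - (c + r * a)) * ((1 + x) * (1 - a) - (c + r * a - 2 * a)) := by
    rw [div_mul_eq_mul_div, div_eq_iff (mul_ne_zero h1x.ne' hd2.ne')]; ring
  have k2 : (c + r * a) / (1 - (c + r * a)) * ((1 - x) * (1 + x - c) * (1 - (c + r * a)) * ((1 + x) * (1 - a) - (c + r * a - 2 * a)))
      = (c + r * a) * (1 - x) * (1 + x - c) * ((1 + x) * (1 - a) - (c + r * a - 2 * a)) := by
    rw [div_mul_eq_mul_div, div_eq_iff hdP.ne']; ring
  have k3 : (x ^ 2 * (1 - a) + (1 - x) * (c + r * a - 2 * a)) / ((1 - x) * ((1 + x) * (1 - a) - (c + r * a - 2 * a)))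
      * ((1 - x) * (1 + x - c) * (1 - (c + r * a)) * ((1 + x) * (1 - a) - (c + r * a - 2 * a)))
      = (x ^ 2 * (1 - a) + (1 - x) * (c + r * a - 2 * a)) * (1 + x - c) * (1 - (c + r * a)) := by
    rw [div_mul_eq_mul_div, div_eq_iff (mul_ne_zero h1x.ne' hW.ne')]; ring
  have hT := poly_Ah x r c a hx0.le (by linarith) hr0 (by linarith) hc0.le (by linarith) ha0.le (by linarith) (by linarith) (by linarith) (by linarith) (by nlinarith [mul_nonneg hx0.le (sub_nonneg.2 hrx.le)]) (by nlinarith [mul_nonneg (sub_nonneg.2 hx1.le) (sub_nonneg.2 hrx.le)]) (by nlinarith) (by nlinarith) (by linarith) (by nlinarith [mul_nonneg ha0.le (sub_nonneg.2 hrx.le)]) (by linarith)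
  refine (mul_nonneg_iff_of_pos_right hD).1 ?_
  have eq : ((1 - (x ^ 2 + (1 - x) * r)) * (UL[x, c] - (c + r * a) / (1 - (c + r * a)))
      + (x ^ 2 + (1 - x) * r) * ((c + r * a) / (1 - (c + r * a))
        - (x ^ 2 * (1 - a) + (1 - x) * (c + r * a - 2 * a)) / ((1 - x) * ((1 + x) * (1 - a) - (c + r * a - 2 * a)))))
      * ((1 - x) * (1 + x - c) * (1 - (c + r * a)) * ((1 + x) * (1 - a) - (c + r * a - 2 * a)))
      = (1 - (x ^ 2 + (1 - x) * r)) * (UL[x, c] * ((1 - x) * (1 + x - c) * (1 - (c + r * a)) * ((1 + x) * (1 - a) - (c + r * a - 2 * a))))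
        - (1 - (x ^ 2 + (1 - x) * r)) * ((c + r * a) / (1 - (c + r * a))
          * ((1 - x) * (1 + x - c) * (1 - (c + r * a)) * ((1 + x) * (1 - a) - (c + r * a - 2 * a))))
        + (x ^ 2 + (1 - x) * r) * ((c + r * a) / (1 - (c + r * a))
          * ((1 - x) * (1 + x - c) * (1 - (c + r * a)) * ((1 + x) * (1 - a) - (c + r * a - 2 * a))))
        - (x ^ 2 + (1 - x) * r) * ((x ^ 2 * (1 - a) + (1 - x) * (c + r * a - 2 * a)) / ((1 - x) * ((1 + x) * (1 - a) - (c + r * a - 2 * a)))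
          * ((1 - x) * (1 + x - c) * (1 - (c + r * a)) * ((1 + x) * (1 - a) - (c + r * a - 2 * a)))) := by ring
  rw [eq, k1, k2, k3]
  linarith [hT]


set_option maxHeartbeats 4000000 in
/-- **(B, heavy `P2`) `ℓ·U_P ≤ v₁·U_P`** (`γ ≤ 1/2`). [this work] -/
theorem R_Bh (x r c a γ ρP ρM : ℝ) (hγ : γ = x ^ 2 + (1 - x) * r) (hρP : ρP = c + r * a) (hρM : ρM = (c + r * a - 2 * a) / (1 - a))
    (hx0 : 0 < x) (hx1 : x < 1) (hr0 : 0 ≤ r) (hrx : r < x) (hcx : c < x) (ha0 : 0 < a) (ha1 : a < 1)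
    (hlc : (2 - r) * a < c) (hP : x ≤ ρP) (hP1 : ρP < 1) (hg : γ ≤ 1 / 2) :
    2 * r * a * (1 - 2 * γ) * (ρP / (1 - ρP)) ≤ (1 - γ) * (UL[x, c] - ρP / (1 - ρP)) + γ * (ρP / (1 - ρP) - UL[x, ρM]) := by
  subst hγ hρP hρM
  have h1x : 0 < 1 - x := by linarith
  have hc0 : 0 < c := by nlinarith
  have hW : 0 < (1 + x) * (1 - a) - (c + r * a - 2 * a) := by nlinarith
  have hd2 : 0 < 1 + x - c := by linarith
  have hdP : 0 < 1 - (c + r * a) := by linarith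
  rw [UL_frac x (c + r * a - 2 * a) (1 - a) hx1 (by linarith) hW.ne']
  have hD : 0 < (1 - x) * (1 + x - c) * (1 - (c + r * a)) * ((1 + x) * (1 - a) - (c + r * a - 2 * a)) :=
    mul_pos (mul_pos (mul_pos h1x hd2) hdP) hW
  have k1 : UL[x, c] * ((1 - x) * (1 + x - c) * (1 - (c + r * a)) * ((1 + x) * (1 - a) - (c + r * a - 2 * a)))
      = (x ^ 2 + (1 - x) * c) * (1 - (c + r * a)) * ((1 + x) * (1 - a) - (c + r * a - 2 * a)) := by
    rw [div_mul_eq_mul_div, div_eq_iff (mul_ne_zero h1x.ne' hd2.ne')]; ring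
  have k2 : (c + r * a) / (1 - (c + r * a)) * ((1 - x) * (1 + x - c) * (1 - (c + r * a)) * ((1 + x) * (1 - a) - (c + r * a - 2 * a)))
      = (c + r * a) * (1 - x) * (1 + x - c) * ((1 + x) * (1 - a) - (c + r * a - 2 * a)) := by
    rw [div_mul_eq_mul_div, div_eq_iff hdP.ne']; ring
  have k3 : (x ^ 2 * (1 - a) + (1 - x) * (c + r * a - 2 * a)) / ((1 - x) * ((1 + x) * (1 - a) - (c + r * a - 2 * a)))
      * ((1 - x) * (1 + x - c) * (1 - (c + r * a)) * ((1 + x) * (1 - a) - (c + r * a - 2 * a)))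
      = (x ^ 2 * (1 - a) + (1 - x) * (c + r * a - 2 * a)) * (1 + x - c) * (1 - (c + r * a)) := by
    rw [div_mul_eq_mul_div, div_eq_iff (mul_ne_zero h1x.ne' hW.ne')]; ring
  have hT := poly_Bh x r c a hx0.le (by linarith) hr0 (by linarith) hc0.le (by linarith) ha0.le (by linarith) (by linarith) (by linarith) (by linarith) (by linarith) (by nlinarith [mul_nonneg hx0.le (sub_nonneg.2 hrx.le)]) (by nlinarith [mul_nonneg (sub_nonneg.2 hx1.le) (sub_nonneg.2 hrx.le)]) (by nlinarith) (by nlinarith) (by linarith) (by nlinarith [mul_nonneg (sub_nonneg.2 hx1.le) (sub_nonneg.2 hlc.le)]) (by nlinarith [mul_nonneg ha0.le (sub_nonneg.2 hrx.le)]) (by linarith) (by nlinarith)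
  rw [← sub_nonneg]
  refine (mul_nonneg_iff_of_pos_right hD).1 ?_
  have eq : ((1 - (x ^ 2 + (1 - x) * r)) * (UL[x, c] - (c + r * a) / (1 - (c + r * a)))
      + (x ^ 2 + (1 - x) * r) * ((c + r * a) / (1 - (c + r * a))
        - (x ^ 2 * (1 - a) + (1 - x) * (c + r * a - 2 * a)) / ((1 - x) * ((1 + x) * (1 - a) - (c + r * a - 2 * a))))
      - 2 * r * a * (1 - 2 * (x ^ 2 + (1 - x) * r)) * ((c + r * a) / (1 - (c + r * a))))
      * ((1 - x) * (1 + x - c) * (1 - (c + r * a)) * ((1 + x) * (1 - a) - (c + r * a - 2 * a)))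
      = (1 - (x ^ 2 + (1 - x) * r)) * (UL[x, c] * ((1 - x) * (1 + x - c) * (1 - (c + r * a)) * ((1 + x) * (1 - a) - (c + r * a - 2 * a))))
        - (1 - (x ^ 2 + (1 - x) * r)) * ((c + r * a) / (1 - (c + r * a))
          * ((1 - x) * (1 + x - c) * (1 - (c + r * a)) * ((1 + x) * (1 - a) - (c + r * a - 2 * a))))
        + (x ^ 2 + (1 - x) * r) * ((c + r * a) / (1 - (c + r * a))
          * ((1 - x) * (1 + x - c) * (1 - (c + r * a)) * ((1 + x) * (1 - a) - (c + r * a - 2 * a))))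
        - (x ^ 2 + (1 - x) * r) * ((x ^ 2 * (1 - a) + (1 - x) * (c + r * a - 2 * a)) / ((1 - x) * ((1 + x) * (1 - a) - (c + r * a - 2 * a)))
          * ((1 - x) * (1 + x - c) * (1 - (c + r * a)) * ((1 + x) * (1 - a) - (c + r * a - 2 * a))))
        - 2 * r * a * (1 - 2 * (x ^ 2 + (1 - x) * r)) * ((c + r * a) / (1 - (c + r * a))
          * ((1 - x) * (1 + x - c) * (1 - (c + r * a)) * ((1 + x) * (1 - a) - (c + r * a - 2 * a)))) := by ring
  rw [eq, k1, k2, k3]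
  linarith [hT]


set_option maxHeartbeats 4000000 in
/-- **(C) `ℓ·U_M ≤ (1−γ)(c₂ − U_M)`** (`γ ≤ 1/2`). [this work] -/
theorem R_C (x r c a γ ρM : ℝ) (hγ : γ = x ^ 2 + (1 - x) * r) (hρM : ρM = (c + r * a - 2 * a) / (1 - a))
    (hx0 : 0 < x) (hx1 : x < 1) (hr0 : 0 ≤ r) (hrx : r < x) (hcx : c < x) (ha0 : 0 < a) (ha1 : a < 1)
    (hlc : (2 - r) * a < c) (hg : γ ≤ 1 / 2) :
    2 * r * a * (1 - 2 * γ) * UL[x, ρM] ≤ (1 - γ) * (UL[x, c] - UL[x, ρM]) := by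
  subst hγ hρM
  have h1x : 0 < 1 - x := by linarith
  have hc0 : 0 < c := by nlinarith
  have hW : 0 < (1 + x) * (1 - a) - (c + r * a - 2 * a) := by nlinarith
  have hd2 : 0 < 1 + x - c := by linarith
  rw [UL_frac x (c + r * a - 2 * a) (1 - a) hx1 (by linarith) hW.ne']
  have hD : 0 < (1 - x) * (1 + x - c) * ((1 + x) * (1 - a) - (c + r * a - 2 * a)) := mul_pos (mul_pos h1x hd2) hW
  have hT := poly_C x r c a hx0.le (by linarith) hr0 (by linarith) hc0.le (by linarith) ha0.le (by linarith) (by linarith) (by linarith) (by nlinarith [mul_nonneg hx0.le (sub_nonneg.2 hrx.le)]) (by nlinarith [mul_nonneg (sub_nonneg.2 hx1.le) (sub_nonneg.2 hrx.le)]) (by nlinarith) (by nlinarith) (by linarith) (by nlinarith [mul_nonneg (sub_nonneg.2 hx1.le) (sub_nonneg.2 hlc.le)]) (by nlinarith [mul_nonneg ha0.le (sub_nonneg.2 hrx.le)]) (by linarith)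
  have k1 : UL[x, c] * ((1 - x) * (1 + x - c) * ((1 + x) * (1 - a) - (c + r * a - 2 * a)))
      = (x ^ 2 + (1 - x) * c) * ((1 + x) * (1 - a) - (c + r * a - 2 * a)) := by
    rw [div_mul_eq_mul_div, div_eq_iff (mul_ne_zero h1x.ne' hd2.ne')]; ring
  have k2 : (x ^ 2 * (1 - a) + (1 - x) * (c + r * a - 2 * a)) / ((1 - x) * ((1 + x) * (1 - a) - (c + r * a - 2 * a)))
      * ((1 - x) * (1 + x - c) * ((1 + x) * (1 - a) - (c + r * a - 2 * a)))
      = (x ^ 2 * (1 - a) + (1 - x) * (c + r * a - 2 * a)) * (1 + x - c) := by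
    rw [div_mul_eq_mul_div, div_eq_iff (mul_ne_zero h1x.ne' hW.ne')]; ring
  rw [← sub_nonneg]
  refine (mul_nonneg_iff_of_pos_right hD).1 ?_
  have eq : ((1 - (x ^ 2 + (1 - x) * r)) * (UL[x, c]
        - (x ^ 2 * (1 - a) + (1 - x) * (c + r * a - 2 * a)) / ((1 - x) * ((1 + x) * (1 - a) - (c + r * a - 2 * a))))
      - 2 * r * a * (1 - 2 * (x ^ 2 + (1 - x) * r))
        * ((x ^ 2 * (1 - a) + (1 - x) * (c + r * a - 2 * a)) / ((1 - x) * ((1 + x) * (1 - a) - (c + r * a - 2 * a)))))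
      * ((1 - x) * (1 + x - c) * ((1 + x) * (1 - a) - (c + r * a - 2 * a)))
      = (1 - (x ^ 2 + (1 - x) * r)) * (UL[x, c] * ((1 - x) * (1 + x - c) * ((1 + x) * (1 - a) - (c + r * a - 2 * a))))
        - (1 - (x ^ 2 + (1 - x) * r)) * ((x ^ 2 * (1 - a) + (1 - x) * (c + r * a - 2 * a)) / ((1 - x) * ((1 + x) * (1 - a) - (c + r * a - 2 * a)))
          * ((1 - x) * (1 + x - c) * ((1 + x) * (1 - a) - (c + r * a - 2 * a))))
        - 2 * r * a * (1 - 2 * (x ^ 2 + (1 - x) * r))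
          * ((x ^ 2 * (1 - a) + (1 - x) * (c + r * a - 2 * a)) / ((1 - x) * ((1 + x) * (1 - a) - (c + r * a - 2 * a)))
          * ((1 - x) * (1 + x - c) * ((1 + x) * (1 - a) - (c + r * a - 2 * a)))) := by ring
  rw [eq, k1, k2]
  have := mul_nonneg ha0.le hT
  linarith


/-- **(D) `ℓ ≤ γ`** (`γ ≤ 1/2`). [this work] -/
theorem R_D (x r c a γ : ℝ) (hγ : γ = x ^ 2 + (1 - x) * r) (hx0 : 0 < x) (hx1 : x < 1) (hr0 : 0 ≤ r) (hrx : r < x) (hcx : c < x)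
    (ha0 : 0 < a) (hlc : (2 - r) * a < c) (hg : γ ≤ 1 / 2) :
    2 * r * a * (1 - 2 * γ) ≤ γ := by
  subst hγ
  have hT := poly_D x r c a hx0.le (by linarith) hr0 (by linarith) (by linarith) ha0.le (by linarith) (by nlinarith [mul_nonneg hx0.le (sub_nonneg.2 hrx.le)])
  linarith


end TwoMidCell

end LawDec

end Quant

end Summit.CriticalPhenomena.PercolationContinuityZ3.Theorems
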